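import Mathlib.Analysis.Normed.Group.Basic
import Mathlib.Algebra.BigOperators.Fin
import Mathlib.GroupTheory.Perm.Basic
import Mathlib.Data.Fintype.Perm
import Literature.MathematicalPhysics.QuantumFieldTheory.Balaban1983to89.B4Eq19LatticeOperators
import HarnessLib

/-!
# Kuhn path sums against the organ's bond sums — the COMBINATORIAL SANDWICH (K2 organ `hImproveCoreFlat`, ORGAN memo §4 brick
# B3, mesh-side half; LINE 25 `stub_latticeToContinuumLimit` (Γ1)∕(Γ2); cell ym3-torus, seat px7 g7)

Helper toward crux `stmt-QuantumFields-19936` (`Summit.QuantumFields.YangMills.Theses.UnitScaleTilt.HistoryTailL`).  Pure lattice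
bookkeeping, Mathlib + `B4Eq19LatticeOperators` only (no measure theory): the per-cube energy of the Courant `P1` interpolant on
the Freudenthal–Kuhn triangulation is `(1∕6)·∑_{σ ∈ S₃}` of the bond energies of the monotone lattice paths
`y → y + e_{σ0} → y + e_{σ0} + e_{σ1} → y + 𝟙` (sibling `PoincareLipschitzKuhnEnergy.integral_cube_energyDensity_eq`); summed over the
corners `y ∈ box z R` this is sandwiched between the organ's lattice Dirichlet energies
`E(B) := ∑_{w ∈ B} ∑_μ ‖u (w + unitVec μ) − u w‖²` of `box z (R−1)` and `box z (R+1)` with constant ONE: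
★`bondEnergy_le_sixth_sum_paths`, ★`sixth_sum_paths_le_bondEnergy`.  Mechanism: for fixed `σ` the `k`-th path step is the bond
`(y + v_k, σ k)` with the `{0,1}`-shift `v_k ∈ {0, e_{σ0}, e_{σ0}+e_{σ1}}` — shifts are injective and move `box z R` into
`box z (R+1)` (`sum_shift_le`) resp. cover `box z (R−1)` (`sum_le_sum_shift`); then `k ↦ σ k` re-indexes the three directions
(`Equiv.sum_comp`) and the six permutations contribute equally (`Fintype.card_perm`).

HONEST: nothing of `stub_latticeToContinuumLimit`, `hImproveCoreFlat`, K1, `MeanDeviationL`, `BlockLipschitzL`, `HistoryTailL` is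
proved; YM₃ on T³ is ladder rung R3 — not d = 4, not infinite volume, not a mass gap, not Clay.
-/

open scoped BigOperators
open Literature.MathematicalPhysics.QuantumFieldTheory.Balaban1983to89 B4Eq19LatticeOperators

noncomputable section

namespace Summit.QuantumFields.YangMills.Theorems.PoincareLipschitzKuhnPathSums

variable {E : Type*} [NormedAddCommGroup E]

/-! ## §7 The combinatorial sandwich: shifting the path sums into the organ's bond sums -/

/-- A shift by a `{0,1}`-vector moves `box z R` into `box z (R+1)`. -/
theorem add_mem_box_succ {z y v : Zd 3} {R : ℤ} (hy : y ∈ box z R) (hv : ∀ i, v i = 0 ∨ v i = 1) :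
    y + v ∈ box z (R + 1) := by
  rw [mem_box] at hy ⊢
  intro i
  have h1 := hy i
  rcases hv i with h | h <;> simp only [Pi.add_apply, h, add_zero] <;>
    [exact h1.trans (by linarith); exact (abs_le.mpr ⟨by linarith [(abs_le.mp h1).1], by linarith [(abs_le.mp h1).2]⟩)]

/-- Conversely, a point of `box z (R-1)` shifted back by a `{0,1}`-vector lies in `box z R`. -/
theorem sub_mem_box_of_mem_box_pred {z w v : Zd 3} {R : ℤ} (hw : w ∈ box z (R - 1)) (hv : ∀ i, v i = 0 ∨ v i = 1) :
    w - v ∈ box z R := by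
  rw [mem_box] at hw ⊢
  intro i
  have h1 := abs_le.mp (hw i)
  rcases hv i with h | h <;> simp only [Pi.sub_apply, h, sub_zero] <;>
    exact abs_le.mpr ⟨by linarith, by linarith⟩

/-- Shifted partial sums are dominated by the full bond sum over `box z (R+1)` (non-negative terms). -/
theorem sum_shift_le {z : Zd 3} {R : ℤ} (f : Zd 3 → ℝ) (hf : ∀ w, 0 ≤ f w) (v : Zd 3) (hv : ∀ i, v i = 0 ∨ v i = 1) :
    ∑ y ∈ box z R, f (y + v) ≤ ∑ w ∈ box z (R + 1), f w := by
  rw [← Finset.sum_image (f := f) (s := box z R) (g := fun y => y + v) (fun a _ b _ h => add_right_cancel h)]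
  refine Finset.sum_le_sum_of_subset_of_nonneg ?_ (fun w _ _ => hf w)
  intro w hw
  obtain ⟨y, hy, rfl⟩ := Finset.mem_image.mp hw
  exact add_mem_box_succ hy hv

/-- Shifted partial sums dominate the bond sum over `box z (R-1)` (non-negative terms). -/
theorem sum_le_sum_shift {z : Zd 3} {R : ℤ} (f : Zd 3 → ℝ) (hf : ∀ w, 0 ≤ f w) (v : Zd 3) (hv : ∀ i, v i = 0 ∨ v i = 1) :
    ∑ w ∈ box z (R - 1), f w ≤ ∑ y ∈ box z R, f (y + v) := by
  rw [← Finset.sum_image (f := f) (s := box z R) (g := fun y => y + v) (fun a _ b _ h => add_right_cancel h)]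
  refine Finset.sum_le_sum_of_subset_of_nonneg ?_ (fun w _ _ => hf w)
  intro w hw
  exact Finset.mem_image.mpr ⟨w - v, sub_mem_box_of_mem_box_pred hw hv, sub_add_cancel w v⟩

/-- The unit vectors and their pairwise sums (distinct directions) are `{0,1}`-vectors. -/
theorem unitVec_coord01 (μ : Fin 3) : ∀ i, unitVec (d := 3) μ i = 0 ∨ unitVec (d := 3) μ i = 1 := by
  intro i; simp only [unitVec, Pi.single_apply]; split_ifs <;> simp

/-- The sum of two distinct unit vectors is a `{0,1}`-vector. -/
theorem unitVec_add_coord01 (σ : Equiv.Perm (Fin 3)) :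
    ∀ i, (unitVec (σ 0) + unitVec (σ 1)) i = 0 ∨ (unitVec (σ 0) + unitVec (σ 1)) i = 1 := by
  intro i
  have hne : σ 0 ≠ σ 1 := fun h => absurd (σ.injective h) (by decide)
  simp only [Pi.add_apply, unitVec, Pi.single_apply]
  by_cases h0 : i = σ 0
  · subst h0; simp [hne]
  · by_cases h1 : i = σ 1
    · subst h1; simp [hne.symm]
    · simp [h0, h1]

/-- ★ UPPER SANDWICH (combinatorial): `(1∕6)·∑_{y ∈ box z R} ∑_σ (path energies at y)` is at most the organ's bond energy over
`box z (R+1)` — every bond differenced along a Kuhn path starts in `box z (R+1)`, and for a fixed `σ` the three shifts are injective. -/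
theorem sixth_sum_paths_le_bondEnergy (u : Zd 3 → E) (z : Zd 3) (R : ℤ) :
    (1 / 6 : ℝ) * ∑ y ∈ box z R, ∑ σ : Equiv.Perm (Fin 3), (‖u (y + unitVec (σ 0)) - u y‖ ^ 2
        + ‖u (y + unitVec (σ 0) + unitVec (σ 1)) - u (y + unitVec (σ 0))‖ ^ 2
        + ‖u (y + unitVec (σ 0) + unitVec (σ 1) + unitVec (σ 2)) - u (y + unitVec (σ 0) + unitVec (σ 1))‖ ^ 2) ≤
      ∑ w ∈ box z (R + 1), ∑ μ : Fin 3, ‖u (w + unitVec μ) - u w‖ ^ 2 := by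
  set f : Zd 3 → Fin 3 → ℝ := fun w μ => ‖u (w + unitVec μ) - u w‖ ^ 2 with hf
  have hf0 : ∀ w μ, 0 ≤ f w μ := fun w μ => by positivity
  -- rewrite the three path terms as shifted `f`'s
  have hterm : ∀ (y : Zd 3) (σ : Equiv.Perm (Fin 3)),
      ‖u (y + unitVec (σ 0)) - u y‖ ^ 2 + ‖u (y + unitVec (σ 0) + unitVec (σ 1)) - u (y + unitVec (σ 0))‖ ^ 2
        + ‖u (y + unitVec (σ 0) + unitVec (σ 1) + unitVec (σ 2)) - u (y + unitVec (σ 0) + unitVec (σ 1))‖ ^ 2 =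
      f (y + 0) (σ 0) + f (y + unitVec (σ 0)) (σ 1) + f (y + (unitVec (σ 0) + unitVec (σ 1))) (σ 2) := by
    intro y σ; simp only [hf, add_zero, add_assoc]
  simp_rw [hterm]
  rw [Finset.sum_comm]
  have hσ : ∀ σ : Equiv.Perm (Fin 3),
      ∑ y ∈ box z R, (f (y + 0) (σ 0) + f (y + unitVec (σ 0)) (σ 1) + f (y + (unitVec (σ 0) + unitVec (σ 1))) (σ 2)) ≤
      ∑ w ∈ box z (R + 1), ∑ μ : Fin 3, f w μ := by
    intro σ
    rw [Finset.sum_add_distrib, Finset.sum_add_distrib]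
    have h0 := sum_shift_le (z := z) (R := R) (fun w => f w (σ 0)) (fun w => hf0 w _) 0 (fun i => Or.inl rfl)
    have h1 := sum_shift_le (z := z) (R := R) (fun w => f w (σ 1)) (fun w => hf0 w _) (unitVec (σ 0))
      (unitVec_coord01 (σ 0))
    have h2 := sum_shift_le (z := z) (R := R) (fun w => f w (σ 2)) (fun w => hf0 w _) (unitVec (σ 0) + unitVec (σ 1))
      (unitVec_add_coord01 σ)
    calc _ ≤ ∑ w ∈ box z (R + 1), f w (σ 0) + ∑ w ∈ box z (R + 1), f w (σ 1) + ∑ w ∈ box z (R + 1), f w (σ 2) :=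
          add_le_add (add_le_add h0 h1) h2
      _ = ∑ w ∈ box z (R + 1), ∑ k : Fin 3, f w (σ k) := by
          rw [← Finset.sum_add_distrib, ← Finset.sum_add_distrib]
          refine Finset.sum_congr rfl fun w _ => ?_
          simp [Fin.sum_univ_three]
      _ = ∑ w ∈ box z (R + 1), ∑ μ : Fin 3, f w μ := by
          refine Finset.sum_congr rfl fun w _ => ?_
          exact Equiv.sum_comp σ (fun μ => f w μ)
  have htot := Finset.sum_le_sum (s := (Finset.univ : Finset (Equiv.Perm (Fin 3)))) (fun σ _ => hσ σ)
  rw [Finset.sum_const, Finset.card_univ, Fintype.card_perm, Fintype.card_fin, nsmul_eq_mul] at htot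
  have h6 : ((Nat.factorial 3 : ℕ) : ℝ) = 6 := by norm_num [Nat.factorial]
  rw [h6] at htot
  linarith

/-- ★ LOWER SANDWICH (combinatorial): the organ's bond energy over `box z (R-1)` is at most `(1∕6)·∑_{y ∈ box z R} ∑_σ (path
energies at y)` — every bond starting in `box z (R-1)` is the `k`-th step of the Kuhn path of `σ` at `y = w − v_k ∈ box z R`,
for each of the six `σ`. -/
theorem bondEnergy_le_sixth_sum_paths (u : Zd 3 → E) (z : Zd 3) (R : ℤ) :
    ∑ w ∈ box z (R - 1), ∑ μ : Fin 3, ‖u (w + unitVec μ) - u w‖ ^ 2 ≤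
      (1 / 6 : ℝ) * ∑ y ∈ box z R, ∑ σ : Equiv.Perm (Fin 3), (‖u (y + unitVec (σ 0)) - u y‖ ^ 2
        + ‖u (y + unitVec (σ 0) + unitVec (σ 1)) - u (y + unitVec (σ 0))‖ ^ 2
        + ‖u (y + unitVec (σ 0) + unitVec (σ 1) + unitVec (σ 2)) - u (y + unitVec (σ 0) + unitVec (σ 1))‖ ^ 2) := by
  set f : Zd 3 → Fin 3 → ℝ := fun w μ => ‖u (w + unitVec μ) - u w‖ ^ 2 with hf
  have hf0 : ∀ w μ, 0 ≤ f w μ := fun w μ => by positivity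
  have hterm : ∀ (y : Zd 3) (σ : Equiv.Perm (Fin 3)),
      ‖u (y + unitVec (σ 0)) - u y‖ ^ 2 + ‖u (y + unitVec (σ 0) + unitVec (σ 1)) - u (y + unitVec (σ 0))‖ ^ 2
        + ‖u (y + unitVec (σ 0) + unitVec (σ 1) + unitVec (σ 2)) - u (y + unitVec (σ 0) + unitVec (σ 1))‖ ^ 2 =
      f (y + 0) (σ 0) + f (y + unitVec (σ 0)) (σ 1) + f (y + (unitVec (σ 0) + unitVec (σ 1))) (σ 2) := by
    intro y σ; simp only [hf, add_zero, add_assoc]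
  simp_rw [hterm]
  conv_rhs => rw [Finset.sum_comm]
  have hσ : ∀ σ : Equiv.Perm (Fin 3),
      ∑ w ∈ box z (R - 1), ∑ μ : Fin 3, f w μ ≤
      ∑ y ∈ box z R, (f (y + 0) (σ 0) + f (y + unitVec (σ 0)) (σ 1) + f (y + (unitVec (σ 0) + unitVec (σ 1))) (σ 2)) := by
    intro σ
    rw [Finset.sum_add_distrib, Finset.sum_add_distrib]
    have h0 := sum_le_sum_shift (z := z) (R := R) (fun w => f w (σ 0)) (fun w => hf0 w _) 0 (fun i => Or.inl rfl)
    have h1 := sum_le_sum_shift (z := z) (R := R) (fun w => f w (σ 1)) (fun w => hf0 w _) (unitVec (σ 0))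
      (unitVec_coord01 (σ 0))
    have h2 := sum_le_sum_shift (z := z) (R := R) (fun w => f w (σ 2)) (fun w => hf0 w _)
      (unitVec (σ 0) + unitVec (σ 1)) (unitVec_add_coord01 σ)
    calc ∑ w ∈ box z (R - 1), ∑ μ : Fin 3, f w μ = ∑ w ∈ box z (R - 1), ∑ k : Fin 3, f w (σ k) := by
          refine Finset.sum_congr rfl fun w _ => ?_
          exact (Equiv.sum_comp σ (fun μ => f w μ)).symm
      _ = ∑ w ∈ box z (R - 1), f w (σ 0) + ∑ w ∈ box z (R - 1), f w (σ 1) + ∑ w ∈ box z (R - 1), f w (σ 2) := by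
          rw [← Finset.sum_add_distrib, ← Finset.sum_add_distrib]
          refine Finset.sum_congr rfl fun w _ => ?_
          simp [Fin.sum_univ_three]
      _ ≤ _ := add_le_add (add_le_add h0 h1) h2
  have htot := Finset.sum_le_sum (s := (Finset.univ : Finset (Equiv.Perm (Fin 3)))) (fun σ _ => hσ σ)
  rw [Finset.sum_const, Finset.card_univ, Fintype.card_perm, Fintype.card_fin, nsmul_eq_mul] at htot
  have h6 : ((Nat.factorial 3 : ℕ) : ℝ) = 6 := by norm_num [Nat.factorial]
  rw [h6] at htot
  linarith

end Summit.QuantumFields.YangMills.Theorems.PoincareLipschitzKuhnPathSums
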